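import Summits.FinalStateConjecture.FinalStateConjecture.Theses.PhaseMixingCapture
import Summits.FinalStateConjecture.FinalStateConjecture.Theorems.PhaseMixingCaptureCaptureSufficesC2DiagonalReduction

/-!
# `CaptureSufficesC2` (item stmt-FinalStateConjecture-14986, route `PhaseMixingCapture`, support rank 6):
# exact logical position after the statement revision p126844 (implication records)

`CaptureSufficesC2 := NearExtremalKappaCapture → BulkKerrCaptureC2 → WeakCosmicCensorshipMGHD →
FinalStateConjecture` is the PRE-revision front end: its censorship hypothesis carries the topology-free
curve-genericity `IsChristodoulouGeneric`, while the re-typed summit asks for TAME genericity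
(`IsTameChristodoulouGeneric`). This file records, kernel-checked and definition-free, where the item
now sits among the route's live cruxes (rank 5 `WeakCosmicCensorshipTame`, stmt-17269; rank 6
`CaptureSufficesTame`, stmt-17270):

* `captureSufficesC2_of_finalStateConjecture` — the summit implies the item (so `¬ CaptureSufficesC2`
  refutes the summit; no cheaper kill);
* `captureSufficesTame_of_captureSufficesC2` — the item implies the live rank-6 crux (tame censorship
  forgets to plain censorship, `weakCosmicCensorshipMGHD_of_tameCensorship`), so a proof of it still
  closes the route;
* `captureSufficesC2_of_tameCruxes` — conversely the two live cruxes of ranks 5 and 6 give the item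
  (its own plain-censorship hypothesis is then idle);
* `captureSufficesC2_iff_tame_and_upgrade` — EXACT DECOMPOSITION: the item is the rank-6 crux together
  with the upgrade "plain-generic censorship ⟹ tame-generic censorship" under the two capture
  hypotheses (the summit implies tame censorship, `tameCensorship_of_finalStateConjecture`), i.e. its
  surplus over `CaptureSufficesTame` is a censorship statement of rank-5 strength, not dynamics;
* `captureSufficesC2_iff_upgrade_of_captureSufficesTame` — hence, once rank 6 is a theorem, the item
  is literally that censorship upgrade.

Nothing here is analysis; the dynamical content lives in stmt-17270 and the censorship content in
stmt-17269.
-/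

-- the doubled `FinalStateConjecture.FinalStateConjecture` path component trips dupNamespace
set_option linter.dupNamespace false

noncomputable section

namespace Summit.FinalStateConjecture.FinalStateConjecture.Theorems.PhaseMixingCaptureCaptureSufficesC2

open Summit.FinalStateConjecture.FinalStateConjecture.Theses.PhaseMixingCapture
  (NearExtremalKappaCapture BulkKerrCaptureC2 WeakCosmicCensorshipMGHD WeakCosmicCensorshipTame
    CaptureSufficesC2 CaptureSufficesTame)

/-- **The summit implies the item**: `CaptureSufficesC2` is a curried conditional with conclusion
`FinalStateConjecture`, so it holds as soon as the summit does (and a refutation of it is a refutation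
of the summit). [folklore] -/
theorem captureSufficesC2_of_finalStateConjecture (h : _root_.FinalStateConjecture) :
    CaptureSufficesC2 :=
  fun _ _ _ ↦ h

/-- **The item implies the live rank-6 crux `CaptureSufficesTame`**: tame weak cosmic censorship
(MGHD form) forgets to the topology-free `WeakCosmicCensorshipMGHD`
(`weakCosmicCensorshipMGHD_of_tameCensorship`), so the pre-revision front end feeds the re-typed one.
[folklore] -/
theorem captureSufficesTame_of_captureSufficesC2 (h : CaptureSufficesC2) : CaptureSufficesTame :=
  fun h₁ h₂ h₃ ↦ h h₁ h₂ (weakCosmicCensorshipMGHD_of_tameCensorship h₃)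

/-- **The two live cruxes give the item**: granted TAME weak cosmic censorship (rank 5,
`WeakCosmicCensorshipTame`) and the re-typed front end (rank 6, `CaptureSufficesTame`), the
pre-revision front end `CaptureSufficesC2` holds — its own plain-censorship hypothesis is idle.
[folklore] -/
theorem captureSufficesC2_of_tameCruxes : Summit.FinalStateConjecture.FinalStateConjecture.Theses.PhaseMixingCapture.WeakCosmicCensorshipTame → Summit.FinalStateConjecture.FinalStateConjecture.Theses.PhaseMixingCapture.CaptureSufficesTame → Summit.FinalStateConjecture.FinalStateConjecture.Theses.PhaseMixingCapture.CaptureSufficesC2 :=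
  fun h₅ h₆ h₁ h₂ _ ↦ h₆ h₁ h₂ h₅

/-- **Exact decomposition of the item.** `CaptureSufficesC2` is equivalent to the conjunction of the
live rank-6 crux `CaptureSufficesTame` and the censorship upgrade
`NearExtremalKappaCapture → BulkKerrCaptureC2 → WeakCosmicCensorshipMGHD → WeakCosmicCensorshipTame`
(forward: the summit implies tame censorship, `tameCensorship_of_finalStateConjecture`; backward: modus
ponens). The surplus of the item over the rank-6 crux is therefore a statement of rank-5 strength
(plain-generic ⟹ tame-generic completeness of `𝓘⁺` under idle capture hypotheses). [folklore] -/
theorem captureSufficesC2_iff_tame_and_upgrade : Summit.FinalStateConjecture.FinalStateConjecture.Theses.PhaseMixingCapture.CaptureSufficesC2 ↔ Summit.FinalStateConjecture.FinalStateConjecture.Theses.PhaseMixingCapture.CaptureSufficesTame ∧ (Summit.FinalStateConjecture.FinalStateConjecture.Theses.PhaseMixingCapture.NearExtremalKappaCapture → Summit.FinalStateConjecture.FinalStateConjecture.Theses.PhaseMixingCapture.BulkKerrCaptureC2 → Summit.FinalStateConjecture.FinalStateConjecture.Theses.PhaseMixingCapture.WeakCosmicCensorshipMGHD → Summit.FinalStateConjecture.FinalStateConjecture.Theses.PhaseMixingCapture.WeakCosmicCensorshipTame)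 := by
  constructor
  · exact fun h ↦ ⟨captureSufficesTame_of_captureSufficesC2 h, fun h₁ h₂ h₃ X _ _ _ _ _ _ ↦
      tameCensorship_of_finalStateConjecture (h h₁ h₂ h₃) X⟩
  · exact fun ⟨h₆, hup⟩ h₁ h₂ h₃ ↦ h₆ h₁ h₂ (hup h₁ h₂ h₃)

/-- **Once rank 6 is a theorem the item IS the censorship upgrade**: granted `CaptureSufficesTame`,
`CaptureSufficesC2 ↔ (NearExtremalKappaCapture → BulkKerrCaptureC2 → WeakCosmicCensorshipMGHD →
WeakCosmicCensorshipTame)`. [folklore] -/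
theorem captureSufficesC2_iff_upgrade_of_captureSufficesTame (h₆ : CaptureSufficesTame) :
    CaptureSufficesC2 ↔
      (NearExtremalKappaCapture → BulkKerrCaptureC2 → WeakCosmicCensorshipMGHD →
        WeakCosmicCensorshipTame) :=
  captureSufficesC2_iff_tame_and_upgrade.trans (and_iff_right h₆)

end Summit.FinalStateConjecture.FinalStateConjecture.Theorems.PhaseMixingCaptureCaptureSufficesC2

end
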